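import Mathlib

/-!
# Parity counting of TPP formats (arithmetic skeleton of `LieExponent.md`, §3.19, Theorem 7)

Solo-blind seat (MatrixMultiplication).  For a TPP triple of positive-dimensional connected
submanifolds of dimensions `a, b, c` in a real Lie group of dimension `d` whose Cartan subgroups have
real dimension `r`, the Lie-exponent bound of Blasiak–Cohn–Grochow–Pratt–Umans
(arXiv:2204.03826, Def. 4.1) is `r / (Σ/3 − (d − r)/2)` with `Σ = a + b + c`; it is `< 3` iff
`2Σ + r > 3d` and `≤ 3` iff `2Σ + r ≥ 3d`.  Two facts feed the count: Lemma 2.1 of the note (two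
members of a TPP triple with a positive-dimensional third member have total dimension `≤ d − 1`;
injectivity of `(x, y) ↦ x⁻¹ y` plus invariance of domain — taken here as the hypotheses
`a + b + 1 ≤ d`, `a + c + 1 ≤ d`, `b + c + 1 ≤ d`), and the parity `d ≡ r (mod 2)`, valid for every
real reductive Lie algebra (`d − r` is the number of roots) — taken as `d = r + 2m`.

The theorems below are the arithmetic skeleton of Theorem 7 ("every connected real reductive Lie
group of rank ≤ 5 and every compact connected Lie group of rank ≤ 6 has Lie exponent ≥ 3"):
* `soloLie_two_sigma_add_three_le` — the cap `2Σ ≤ 3d − 3`;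
* `soloLie_no_sub_three_format_of_rank_le_four` — for `r ≤ 4` no format certifies `< 3`;
* `soloLie_sub_three_format_rank_five` — for `r = 5` a sub-3 format is the hyperplane format
  `a = b = c = (d − 1)/2` (excluded geometrically by Corollary 6.1 of the note);
* `soloLie_sub_three_format_rank_six` — for `r = 6` it is `(d/2, d/2 − 1, d/2 − 1)` (excluded in
  compact type by Remark 6.5(a));
* `soloLie_three_format_rank_three` — for `r = 3` the format certifying exactly `3` is again the
  hyperplane format (so compact rank-3 groups of dimension ≥ 5 have Lie exponent ≥ 9/2);
* `soloLie_excess_step` — EXCESS BOOKKEEPING: under one pinned slicing step (all members integral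
  to a common `ker μ` with `dim 𝔤^μ = z`, `d − z = 2k` the rank of the Kirillov form, slices of
  dimensions `a' ≥ a − k`, … inside the `(z − 1)`-dimensional group `ker(μ|G^μ)₀` of rank `r − 1`)
  the doubled excess `2Σ + r − 3d` increases by at least `2`, while by the cap it is at most
  `r − 3`: pinning at every level would exclude sub-3 triples in every rank, and
  `soloLie_eight_le_rank_of_pinned_step` — a single fully pinned step already needs `r ≥ 8`.
All proofs are linear arithmetic (`omega`); the geometry is in the note.
-/

set_option linter.dupNamespace false

namespace Summit.MatrixMultiplication.MatrixMultiplication.Theorems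

/-- The cap from Lemma 2.1: pairwise `≤ d − 1` gives `2Σ + 3 ≤ 3d`. -/
theorem soloLie_two_sigma_add_three_le {a b c d : ℕ} (hab : a + b + 1 ≤ d) (hac : a + c + 1 ≤ d)
    (hbc : b + c + 1 ≤ d) : 2 * (a + b + c) + 3 ≤ 3 * d := by
  omega

/-- Rank `≤ 4` (with `d ≡ r (mod 2)`): no format certifies a Lie-exponent bound `< 3`,
i.e. `2Σ + r ≤ 3d`. -/
theorem soloLie_no_sub_three_format_of_rank_le_four {a b c d r m : ℕ} (hd : d = r + 2 * m)
    (hr : r ≤ 4) (hab : a + b + 1 ≤ d) (hac : a + c + 1 ≤ d) (hbc : b + c + 1 ≤ d) :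
    2 * (a + b + c) + r ≤ 3 * d := by
  omega

/-- Rank `5`: a format certifying `< 3` (`2Σ + 5 > 3d`) is the hyperplane format
`a = b = c = (d − 1)/2`. -/
theorem soloLie_sub_three_format_rank_five {a b c d m : ℕ} (hd : d = 5 + 2 * m)
    (hab : a + b + 1 ≤ d) (hac : a + c + 1 ≤ d) (hbc : b + c + 1 ≤ d)
    (h : 3 * d < 2 * (a + b + c) + 5) : 2 * a + 1 = d ∧ 2 * b + 1 = d ∧ 2 * c + 1 = d := by
  omega

/-- Rank `6`: a format certifying `< 3` (`2Σ + 6 > 3d`), written with `a ≥ b ≥ c`, is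
`(d/2, d/2 − 1, d/2 − 1)` — two "hyperplane pairs" `a + b = a + c = d − 1`. -/
theorem soloLie_sub_three_format_rank_six {a b c d m : ℕ} (hd : d = 6 + 2 * m)
    (hab : a + b + 1 ≤ d) (hac : a + c + 1 ≤ d) (hbc : b + c + 1 ≤ d) (hba : b ≤ a) (hcb : c ≤ b)
    (h : 3 * d < 2 * (a + b + c) + 6) : 2 * a = d ∧ 2 * b + 2 = d ∧ 2 * c + 2 = d := by
  omega

/-- Rank `3`: the format certifying exactly `3` (`2Σ + 3 ≥ 3d`) is the hyperplane format; hence in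
compact type (where the hyperplane format is excluded for `d ≥ 5`) the next value certifies only
`3r/(r−1) = 9/2`. -/
theorem soloLie_three_format_rank_three {a b c d m : ℕ} (hd : d = 3 + 2 * m)
    (hab : a + b + 1 ≤ d) (hac : a + c + 1 ≤ d) (hbc : b + c + 1 ≤ d)
    (h : 3 * d ≤ 2 * (a + b + c) + 3) : 2 * a + 1 = d ∧ 2 * b + 1 = d ∧ 2 * c + 1 = d := by
  omega

/-- Rank `7`: a format certifying `< 3` is the hyperplane format or one of the two formats one below
it, `((d−1)/2, (d−1)/2, (d−3)/2)` and `((d+1)/2, (d−3)/2, (d−3)/2)` (with `a ≥ b ≥ c`) — the cases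
left open by Theorem 7. -/
theorem soloLie_sub_three_format_rank_seven {a b c d m : ℕ} (hd : d = 7 + 2 * m)
    (hab : a + b + 1 ≤ d) (hac : a + c + 1 ≤ d) (hbc : b + c + 1 ≤ d) (hba : b ≤ a) (hcb : c ≤ b)
    (h : 3 * d < 2 * (a + b + c) + 7) :
    (2 * a + 1 = d ∧ 2 * b + 1 = d ∧ 2 * c + 1 = d) ∨
      (2 * a + 1 = d ∧ 2 * b + 1 = d ∧ 2 * c + 3 = d) ∨
      (2 * a = d + 1 ∧ 2 * b + 3 = d ∧ 2 * c + 3 = d) := by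
  omega

/-- **Excess bookkeeping (LieExponent.md §3.19, Remark 4).**  One pinned slicing step: the ambient
data `(d, r)` become `(z − 1, r − 1)` where `d − z = 2k` is the rank of the Kirillov form of the
pinning functional, and the member dimensions drop by at most `k` each (isotropy, Lemma 3.18(d)).
Then the doubled excess `2Σ + r − 3d` grows by at least `2`:
`(2Σ + r − 3d) + 2 ≤ 2Σ' + (r − 1) − 3(z − 1)`, stated additively over `ℕ`
(with `r = r' + 1`, `z = z' + 1`). -/
theorem soloLie_excess_step {a b c a' b' c' d r' z' k : ℕ} (hd : d = z' + 1 + 2 * k)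
    (ha : a ≤ a' + k) (hb : b ≤ b' + k) (hc : c ≤ c' + k) :
    2 * (a + b + c) + (r' + 1) + 3 * z' + 2 ≤ 2 * (a' + b' + c') + r' + 3 * d := by
  omega

/-- Consequence of the step, the cap and parity: if a sub-3 triple (`2Σ + r > 3d`, `d ≡ r (mod 2)`)
admits ONE pinned slicing step whose slices are again positive-dimensional members of a TPP triple
in the `(z − 1)`-dimensional group (so the cap `2Σ' + 3 ≤ 3(z − 1)` holds for them), then `r ≥ 8`.
So in rank `≤ 7` a sub-3 triple is never pinned by a functional `μ` with `μ|𝔤^μ ≠ 0` — the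
numerical reason why Theorem 7 closes ranks 5 and 6 (where a hyperplane pair forces pinning) and why
only partially pinned configurations remain in rank 7. -/
theorem soloLie_eight_le_rank_of_pinned_step {a b c a' b' c' d r m z' k : ℕ}
    (hpar : d = r + 2 * m) (hd : d = z' + 1 + 2 * k)
    (ha : a ≤ a' + k) (hb : b ≤ b' + k) (hc : c ≤ c' + k)
    (hsub : 3 * d < 2 * (a + b + c) + r)
    (hcap' : 2 * (a' + b' + c') + 3 ≤ 3 * z') : 8 ≤ r := by
  omega

end Summit.MatrixMultiplication.MatrixMultiplication.Theorems
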